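import Literature.MathematicalPhysics.QuantumFieldTheory.Balaban1983to89.B2Eq246ScalarStep

/-!
# `Balaban1983to89.B2Eq230CondShift` — T. Bałaban, *(Higgs)₂,₃ quantum fields in a finite volume. II. An upper bound*,
Commun. Math. Phys. **86** (1982) 555–594 [Balaban1982Higgs2] p. 563: the SHIFT `−A_Λ⁻¹Aφ↾_{Λᶜ}` of the conditional
Gaussian integration (2.28) for the CONCRETE scalar quadratic form of the (Higgs)₂,₃ model, and its boundary-bond form
**(2.29)/(2.30)** — *"φ′(x) + Σ_{b∈st(Λ₅)} C^{(0)}_{Λ₅}(B^{(1)}; x, b₋)U(B_b^{(1)})φ′(b₊), x ∈ Λ₅"* — PROVED hypothesis-free on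
the concrete carrier at the first step (`Λ₅` a union of blocks, Neumann region `Ω` arbitrary)

statement-level skeleton of published theorems with citation tags; proofs where landed; nothing here is a claim about the Yang–Mills mass gap

PDFs held: `paper:balaban1982-cmp86-higgs23-ii` (journal page = PDF page + 554), p. 563 [PDF 9]; `paper:balaban1982-cmp85-higgs23-i`
(journal page = PDF page + 602), pp. 604–605, 608–611 [PDF 2–3, 6–9] — read AS IMAGES on the ×2 renders
`run/shared/lean/pub/pub-balaban/b2b-balaban-ref1/pages/1982-cmp86-higgs23-II/1982-cmp86-higgs23-II-p009-x2.png`,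
`…/1982-cmp85-higgs23-I/1982-cmp85-higgs23-I-p002, -p003, -p006 … -p009-x2.png`.

CITATION HEADER (lean-in-tree rule).  lit-balaban typed skeleton (HOME `run/shared/lean/pub/lit-balaban/`), typer line
(concrete carriers), gen 6.  SKELETON row served: **B2.Eq2.42** ((2.20)–(2.42), fold owner r02, second reader r14), members
**(2.29)/(2.30)** p. 563 — typed of record at the component level by p15's `B2Eq228Conditioning.display229` /
`B2Eq234SecondRepr.display230` (the abstract finite-dimensional model: *if* the matrix `A` couples `Λ` to `Λᶜ` only through a
set `st` of component pairs with couplings `−u_b`, hypotheses `hst`/`hunit`/`hu`).  THIS FILE supplies the CONCRETE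
instance: for the concrete scalar form at the first step these hypotheses are THEOREMS (the one-step `P(A)` is block-diagonal
and the Neumann covariant Laplacian is of nearest-neighbour type), and the printed display holds as an identity of fields.
NOTHING of record is restated: the (2.28) apparatus (`In/Out/resIn/resOut/glue/blkIn/blkMix`, `condShift`, `model`) IS p15's
`B2Eq228Conditioning`; the coordinates ARE p34's `B1Eq221Coordinates.fieldCoord` / p35's `B1Eq230FluctCov.mat`; the operators
ARE p35's `precOpA` = `a(L^{k+1}ε)^{−2}P(A) + Δ^{(k),L^kε}(Ω,A)` (I (2.30)), `avgQLin/avgQAdjLin` (I (2.7)), the typer's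
`HiggsCovariance.covLaplacianN`/`kernel` (I (2.17), (2.24)), `HiggsCondCov232.condCov232` = `C^{(k)}_Λ(Ω,A)` (I (2.32)),
`HiggsCondGauss228.formMat`/`fieldOfCrd`/`display228_model` (II (2.28) for the model), `B2Eq246ScalarStep.fieldOfOut`.

THE SOURCE TEXT, p. 563 [PDF 9], verbatim.  *"… it will be a conditional integration with conditioning on Λ₅ᶜ. Let us
recall this operation in a general case. Let Ω be a finite set, Λ ⊂ Ω, and let A be a positive operator on a space of field
configurations on Ω, A_Λ its restriction on Λ. Then we have ∫Π_{x∈Ω}dφ(x) exp(−½⟨φ,Aφ⟩) exp(⟨f,φ⟩) F(φ↾_Λ) G(φ↾_{Λᶜ})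
= ∫Π_{x∈Ω}dφ(x) exp(−½⟨φ,Aφ⟩) exp(⟨f,φ⟩) G(φ↾_{Λᶜ}) · ∫dμ_{A_Λ⁻¹}(φ′) F(φ′ − A_Λ⁻¹Aφ↾_{Λᶜ} + A_Λ⁻¹f), (2.28) where
dμ_{A_Λ⁻¹} is a probabilistic Gaussian measure with the covariance A_Λ⁻¹. In our case A is given by the main quadratic form
in the fields A′, φ′, f is obvious, Λ = Λ₅ … The expression (φ′ − A_Λ⁻¹Aφ↾_{Λᶜ})(x) for vector fields has the form
A′(x) + Σ_{b∈st(Λ₅)} C^{(0)}_{Λ₅}(x, b₋)A′(b₊), x ∈ Λ₅, (2.29) and for scalar fields φ′(x) + Σ_{b∈st(Λ₅)} C^{(0)}_{Λ₅}(B^{(1)};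
x, b₋)U(B_b^{(1)})φ′(b₊), x ∈ Λ₅. (2.30) Because the fields A′, φ′ are small on ∂Λ₅ = {x ∈ Λ₅ᶜ : x = b₊ for some b ∈ st(Λ₅)},
the second terms in (2.29), (2.30) can be estimated by O(1)p(ε) …"*; p. 558 [PDF 4] (2.7)–(2.8): the regions `Λ_i` are
*"the sum of … large blocks of T₁"* (so `Λ₅` is a union of blocks `B(y)`); I p. 604 [PDF 2]: bonds `b = ⟨b₋, b₊⟩`,
`A_{−b} = −A_b`; I p. 605: `U(A)* = U(−A)`; I p. 609: *"−Δ^{ε,N}_{A,Ω} is a covariant Laplace operator on the set Ω with Neumann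
boundary conditions"*; I p. 611 (2.32): `C^{(k)}_Λ(Ω, A) = ((aL^{−2}P(A) + Δ^{(k)}(Ω, A))↾_Λ)^{−1}`.

DICTIONARY (print ↦ Lean).  The main quadratic form in `φ′` at level `k` ↦ p35's `precOpA C Ω A msq a k` (its coordinate
matrix for (2.28) is the typer's `formMat` = `(L^kε)^d · mat precOpA`); `A_Λ⁻¹ = C^{(k)}_Λ(Ω,A)` ↦ `condCov232 C Ω A msq a k Λ`
(`HiggsCondGauss228.inv_blkIn_formMat`); the shift `−A_Λ⁻¹Aφ↾_{Λᶜ}` (source `f = 0`; the `A_Λ⁻¹f` part is the source term,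
untouched) ↦ **`condShiftField C Ω A msq a k Λ φ′ := −C^{(k)}_Λ(Ω,A)·Λ·(a(L^{k+1}ε)^{−2}P(A) + Δ^{(k)}(Ω,A))·Λᶜφ′`**, a field
on `T^{(k)}` supported in `Λ`; at the first step (`k = 0`, `T^{(0)} = T_ε`, the external field `A` in the rôle of `B^{(1)}`):
`Λ₅` ↦ `Λ = blockSet Λ′` (`B(Λ′)`, a union of blocks), `st(Λ₅)` — the bonds `b = ⟨b₋, b₊⟩` INSIDE `Ω` (Neumann: both
endpoints in `Ω`) with `b₋ ∈ Λ`, `b₊ ∉ Λ`, in either orientation — ↦ the positively oriented bonds `stFwd Ω Λ` (`b₋ = b.src`,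
`b₊ = b.tgt`, `U(B_b) = U(A b)`) together with the positively oriented bonds `stBwd Ω Λ` read REVERSED (`b₋ = b.tgt`,
`b₊ = b.src`, `U(B_{−b}) = U(−A b)`, p. 604/605); the kernel `C^{(0)}_{Λ₅}(B^{(1)}; x, b₋)` (an `N × N` matrix) ↦
`HiggsCovariance.kernel (condCov232 …) x b₋ : ℝ^N →ₗ ℝ^N`, the UNWEIGHTED coordinate kernel `(Cψ)(x) = Σ_{x′} C(x,x′)ψ(x′)`
(`apply_eq_sum_kernel`); `∂Λ₅` ↦ `bdrySites Ω Λ`.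

WHAT THIS FILE PROVES (0 sorry; standard axioms; definitions with bodies + theorems).
§1 (every level `k`) `condShiftField` (DEF WITH BODY); supported in `Λ` (`condShiftField_apply_of_not_mem`), a function of
   `Λᶜφ′` only (`condShiftField_cutTo_compl`); **IT IS p15's shift**: `condShift (inSet Λ) formMat f y = (formMat)_Λ⁻¹·f↾_Λ +
   (fieldCoord (condShiftField … (fieldOfOut Λ y)))↾_Λ` (`condShift_formMat`; `condShift_formMat_zero` at `f = 0`;
   `model_formMat_shift`: the `shift` of the carrier `model (inSet Λ) formMat 0 F G` of `HiggsCondGauss228.display228_model` IS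
   `fieldCoord ∘ condShiftField ∘ (Λᶜ·)` — so II (2.28) for the model integrates `F(φ′ + condShiftField(Λᶜφ))`), for m² > 0,
   a > 0, L > 1, k ≤ K, every `Ω`, `A`, `C`, `Λ`.
§2 (first step, `k = 0`) `stFwd`, `stBwd`, `bdrySites` (DEFS WITH BODIES); the kernel expansion `apply_eq_sum_kernel`,
   `kernel_apply_single`; **the boundary-coupling identity** `cutTo_precOpA_cutTo_compl`: for `Λ = B(Λ′)`,
   `Λ·(a(Lε)^{−2}P(A) + (−Δ^{ε,N}_{A,Ω} + m²))·Λᶜφ = −ε⁻²·bdryField φ` with `bdryField φ = Σ_{b∈stFwd} δ_{b.src}U(A_b)φ(b.tgt) +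
   Σ_{b∈stBwd} δ_{b.tgt}U(−A_b)φ(b.src)` (`bdryField_eq_sum_single`) — `P(A)` does not couple `Λ` to `Λᶜ`
   (`blockProjA_cutTo_compl_apply`), the mass term does not, the Neumann Laplacian couples exactly through `st(Λ)`.
§3 **(2.30) PROVED**: `condShiftField_zero_apply` — for EVERY `C, Ω, A, m², a, Λ′, φ′, x` (no positivity needed: both sides are
   built from the same `condCov232`), `condShiftField C Ω A msq a 0 (blockSet Λ′) φ′ x = ε⁻²·[Σ_{b∈stFwd} K(x, b.src)·U(A_b)φ′(b.tgt)
   + Σ_{b∈stBwd} K(x, b.tgt)·U(−A_b)φ′(b.src)]`; the printed shape `display230_concrete` (`(φ′ + shift)(x) = φ′(x) + …`, `x ∈ Λ`);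
   **(2.29)** = the same at external field `0` (`U ≡ 1`; the vector species of the typer's files: `N = d`, trivial
   coupling): `condShiftField_zero_field_apply`; and p. 563's `∂Λ₅`: the shift depends on `φ′` only through `φ′↾_{∂Λ₅}`
   (`condShiftField_eq_of_eqOn_bdrySites`).
§4 (v1.1) **p. 563 «Because the fields A′, φ′ are small on ∂Λ₅ …, the second terms in (2.29), (2.30) can be estimated by O(1)p(ε)»
   — the MECHANISM, PROVED**: `norm_condShiftField_zero_le` — if the kernel of `C^{(0)}_Λ` is dominated entrywise in operator
   norm, `‖C^{(0)}_Λ(x,x′)v‖ ≤ c(x,x′)‖v‖` (the (2.34)-shaped input, r14's concrete `B1Ineq234Concrete` line supplies such `c`),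
   and `‖φ′‖ ≤ p` on `∂Λ`, then `‖shift(x)‖ ≤ ε⁻²·(2d·Σ_{x′}c(x,x′))·p` (unitarity `|U(A_b)v| = |v|`; each site carries `d`
   outgoing and `d` incoming bonds: `sum_pbond_src`/`sum_pbond_tgt`); the `O(1)` is thus `2d·sup_xΣ_{x′}c(x,x′)` times the
   lattice factor — its ε-uniform size is (2.34)'s business and is NOT asserted here.
HONEST SCOPE.  (a) Stated on `T_ε` with the (1.5)-operators of the tree: the factor `ε⁻²` multiplies the UNWEIGHTED kernel of
`C^{(0)}_Λ` on `T_ε`; on the print's unit lattice `T₁` (rescaling (1.22); the typer's `B1Eq38Rescale`) this factor is `1` and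
the display is literally (2.30) — the rescaling is not re-spelled here.  (b) The nearest-neighbour form is a FIRST-STEP fact
(`Δ^{(0)} = −Δ^{ε,N}_{A,Ω} + m²`); at `k ≥ 1` the operator `Δ^{(k)}` (I (2.21)) is not of nearest-neighbour type and (2.46)
prints full bilinear forms instead (typer `B2Eq246ScalarStep`), which is why §3 is `k = 0` only while §1 is every `k`.
(c) The estimate *"can be estimated by O(1)p(ε)"* is proved only as the mechanism of §4 (modulo a (2.34)-shaped kernel bound, r14 `B1Ineq234Concrete`); no ε-uniform constant is asserted here.  Value =
the printed shift of II (2.28) identified on the concrete carrier, consumable by name; NOT summit progress.  Unit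
`lit-balaban-typer` gen 6 (literature-prover-lit-balaban-typer-g6-0); HOME/FILED.md records the proposal.
-/

open scoped BigOperators InnerProductSpace Matrix
open _root_.MeasureTheory Matrix

namespace Literature.MathematicalPhysics.QuantumFieldTheory.Balaban1983to89.B2Eq230CondShift

open HiggsLattice HiggsAveraging HiggsCovariance HiggsCovariancePos HiggsCovarianceCont B1Eq27StepAdjoint
  B1Eq221Coordinates B1Eq230FluctCov HiggsCondCov232 HiggsCondGauss228 B2Eq255Concrete B2Eq246ScalarStep
open B2Eq228Conditioning (In Out resIn resOut glue blkIn blkMix model condShift)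

variable {P : HiggsLattice.Params} {N : ℕ}

/-! ## §1 The shift of (2.28) for the concrete scalar form, at every level `k` -/

section Shift

variable (C : ChargeData N) (Ω : Finset (HiggsLattice.Site P 0)) (A : HiggsLattice.VecField P 0) (msq a : ℝ)

/-- **The shift `−A_Λ⁻¹Aφ↾_{Λᶜ}` of II (2.28) for the concrete scalar quadratic form at level `k`**, as a field on `T^{(k)}`:
`condShiftField … k Λ φ′ = −C^{(k)}_Λ(Ω,A)·(Λ·(a(L^{k+1}ε)^{−2}P(A) + Δ^{(k),L^kε}(Ω,A))·Λᶜφ′)` (`C^{(k)}_Λ(Ω,A) = A_Λ⁻¹` by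
(2.32); the source part `A_Λ⁻¹f` of the printed argument is not included).  Its expansion at `k = 0` is (2.30).
[cite: Balaban1982Higgs2, (2.28) p.563] -/
noncomputable def condShiftField (k : ℕ) (Λ : Finset (HiggsLattice.Site P k)) (φ : ScalarField P k N) : ScalarField P k N :=
  -(condCov232 C Ω A msq a k Λ (cutTo Λ (precOpA C Ω A msq a k (cutTo Λᶜ φ))))

/-- Unfolding of `condShiftField`. [cite: Balaban1982Higgs2, (2.28) p.563] -/
theorem condShiftField_eq (k : ℕ) (Λ : Finset (HiggsLattice.Site P k)) (φ : ScalarField P k N) :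
    condShiftField C Ω A msq a k Λ φ
      = -(condCov232 C Ω A msq a k Λ (cutTo Λ (precOpA C Ω A msq a k (cutTo Λᶜ φ)))) := rfl

/-- The shift is supported in `Λ` (it is a configuration `Λ → R^N`, extended by `0`). [cite: Balaban1982Higgs2, (2.28) p.563] -/
theorem condShiftField_apply_of_not_mem (k : ℕ) (Λ : Finset (HiggsLattice.Site P k)) (φ : ScalarField P k N)
    {x : HiggsLattice.Site P k} (hx : x ∉ Λ) : condShiftField C Ω A msq a k Λ φ x = 0 := by
  rw [condShiftField_eq, Pi.neg_apply, condCov232_apply_of_not_mem C Ω A msq a k Λ _ hx, neg_zero]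

/-- `Λ·(shift) = shift`. [cite: Balaban1982Higgs2, (2.28) p.563] -/
theorem cutTo_condShiftField (k : ℕ) (Λ : Finset (HiggsLattice.Site P k)) (φ : ScalarField P k N) :
    cutTo Λ (condShiftField C Ω A msq a k Λ φ) = condShiftField C Ω A msq a k Λ φ := by
  funext x
  by_cases hx : x ∈ Λ
  · rw [cutTo_of_mem Λ _ hx]
  · rw [cutTo_of_not_mem Λ _ hx, condShiftField_apply_of_not_mem C Ω A msq a k Λ φ hx]

/-- The shift depends on `φ` only through `φ↾_{Λᶜ}`. [cite: Balaban1982Higgs2, (2.28) p.563] -/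
theorem condShiftField_cutTo_compl (k : ℕ) (Λ : Finset (HiggsLattice.Site P k)) (φ : ScalarField P k N) :
    condShiftField C Ω A msq a k Λ (cutTo Λᶜ φ) = condShiftField C Ω A msq a k Λ φ := by
  rw [condShiftField_eq, condShiftField_eq, cutTo_cutTo]

/-- `resIn` commutes with scalars (definitional). [folklore] [cite: Balaban1982Higgs2, (2.28) p.563] -/
theorem resIn_smul {S : Type} (p : S → Prop) (c : ℝ) (v : S → ℝ) : resIn p (c • v) = c • resIn p v := rfl

/-- `resIn` commutes with negation (definitional). [folklore] [cite: Balaban1982Higgs2, (2.28) p.563] -/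
theorem resIn_neg {S : Type} (p : S → Prop) (v : S → ℝ) : resIn p (-v) = -resIn p v := rfl

/-- **`condShiftField` IS p15's shift of (2.28) for `A = formMat`** (general source `f`): in p34's coordinates,
`condShift (inSet Λ) formMat f y = (formMat)_Λ⁻¹·f↾_Λ + (fieldCoord (condShiftField … (fieldOfOut Λ y)))↾_Λ` — the printed
`−A_Λ⁻¹Aφ↾_{Λᶜ} + A_Λ⁻¹f` with its first summand identified (m² > 0, a > 0, L > 1, k ≤ K; every `Ω`, `A`, `C`, `Λ`, `f`, `y`).
[cite: Balaban1982Higgs2, (2.28) p.563] -/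
theorem condShift_formMat {msq a : ℝ} (hmsq : 0 < msq) (ha : 0 < a) (hL : 1 < (P.L : ℝ)) {k : ℕ} (hk : k ≤ P.K)
    (Λ : Finset (HiggsLattice.Site P k)) (f : HiggsLattice.Site P k × Ix N → ℝ) (y : Out (inSet (P := P) N Λ) → ℝ) :
    condShift (inSet N Λ) (formMat C Ω A msq a k) f y
      = (blkIn (inSet N Λ) (formMat C Ω A msq a k))⁻¹ *ᵥ resIn (inSet N Λ) f
        + resIn (inSet N Λ) (fieldCoord (E N) (HiggsLattice.Site P k)
            (condShiftField C Ω A msq a k Λ (fieldOfOut Λ y))) := by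
  have hw : (P.mesh k ^ P.d) ≠ 0 := (pow_pos (P.mesh_pos k) _).ne'
  have hmix : blkMix (inSet N Λ) (formMat C Ω A msq a k) *ᵥ y
      = (P.mesh k ^ P.d) • resIn (inSet N Λ) (fieldCoord (E N) (HiggsLattice.Site P k)
          (precOpA C Ω A msq a k (fieldOfOut Λ y))) := by
    rw [← B2Eq228Conditioning.resIn_mulVec_glue_zero (inSet N Λ) (formMat C Ω A msq a k) y,
      ← fieldCoord_fieldOfOut, formMat, Matrix.smul_mulVec, mat_mulVec, resIn_smul]
  have key : (blkIn (inSet N Λ) (formMat C Ω A msq a k))⁻¹ *ᵥ (blkMix (inSet N Λ) (formMat C Ω A msq a k) *ᵥ y)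
      = -resIn (inSet N Λ) (fieldCoord (E N) (HiggsLattice.Site P k)
          (condShiftField C Ω A msq a k Λ (fieldOfOut Λ y))) := by
    rw [hmix, Matrix.mulVec_smul, inv_blkIn_formMat C Ω A hmsq ha hL hk Λ, Matrix.smul_mulVec, smul_smul,
      mul_inv_cancel₀ hw, one_smul, blkIn_mat_mulVec, fieldOfCrd_resIn, condShiftField_eq, cutTo_compl_fieldOfOut,
      map_neg, resIn_neg, neg_neg]
  rw [condShift, Matrix.mulVec_sub, key, sub_neg_eq_add]

/-- **The case `f = 0`**: `condShift (inSet Λ) formMat 0 y = (fieldCoord (condShiftField … (fieldOfOut Λ y)))↾_Λ` — the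
printed `−A_Λ⁻¹Aφ↾_{Λᶜ}` of (2.28)/(2.30) on the concrete carrier. [cite: Balaban1982Higgs2, (2.30) p.563] -/
theorem condShift_formMat_zero {msq a : ℝ} (hmsq : 0 < msq) (ha : 0 < a) (hL : 1 < (P.L : ℝ)) {k : ℕ} (hk : k ≤ P.K)
    (Λ : Finset (HiggsLattice.Site P k)) (y : Out (inSet (P := P) N Λ) → ℝ) :
    condShift (inSet N Λ) (formMat C Ω A msq a k) 0 y
      = resIn (inSet N Λ) (fieldCoord (E N) (HiggsLattice.Site P k)
          (condShiftField C Ω A msq a k Λ (fieldOfOut Λ y))) := by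
  rw [condShift_formMat C Ω A hmsq ha hL hk Λ 0 y]
  have h0 : resIn (inSet N Λ) (0 : HiggsLattice.Site P k × Ix N → ℝ) = 0 := rfl
  rw [h0, Matrix.mulVec_zero, zero_add]

/-- **The shift of the carrier of `HiggsCondGauss228.display228_model` at source `0` IS `condShiftField`**: for the model
`X = model (inSet Λ) formMat 0 F G` of II (2.28) and every configuration `φ` (in coordinates),
`X.shift (fieldCoord φ) = fieldCoord (condShiftField … Λ (Λᶜφ))` — so the conditional integrand of (2.28) for the concrete
scalar form reads `F(φ′ + condShiftField(Λᶜφ))`, the argument whose expansion is (2.30). [cite: Balaban1982Higgs2, (2.28) p.563] -/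
theorem model_formMat_shift {msq a : ℝ} (hmsq : 0 < msq) (ha : 0 < a) (hL : 1 < (P.L : ℝ)) {k : ℕ} (hk : k ≤ P.K)
    (Λ : Finset (HiggsLattice.Site P k)) (F₀ : (In (inSet (P := P) N Λ) → ℝ) → ℝ)
    (G₀ : (Out (inSet (P := P) N Λ) → ℝ) → ℝ) (φ : ScalarField P k N) :
    (model (inSet N Λ) (formMat C Ω A msq a k) 0 F₀ G₀).shift (fieldCoord (E N) (HiggsLattice.Site P k) φ)
      = fieldCoord (E N) (HiggsLattice.Site P k) (condShiftField C Ω A msq a k Λ (cutTo Λᶜ φ)) := by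
  rw [B2Eq228Conditioning.model_shift, condShift_formMat_zero C Ω A hmsq ha hL hk Λ, fieldOfOut_resOut,
    ← fieldCoord_cutTo, cutTo_condShiftField]

end Shift

/-! ## §2 The first step: the boundary bonds `st(Λ)` and the `Λᶜ → Λ` coupling of the main quadratic form -/

section Boundary

variable {k : ℕ}

/-- **`st(Λ)`, forward part**: the positively oriented bonds `b = ⟨b.src, b.src + ηe_μ⟩` lying INSIDE `Ω` (Neumann: both
endpoints in `Ω`) and LEAVING `Λ`: `b₋ = b.src ∈ Λ`, `b₊ = b.tgt ∉ Λ`. [cite: Balaban1982Higgs2, (2.29) p.563] -/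
def stFwd (Ω Λ : Finset (HiggsLattice.Site P k)) : Finset (HiggsLattice.PBond P k) :=
  Finset.univ.filter fun b => b.src ∈ Ω ∧ b.tgt ∈ Ω ∧ b.src ∈ Λ ∧ b.tgt ∉ Λ

/-- **`st(Λ)`, backward part**: the positively oriented bonds inside `Ω` ENTERING `Λ` (`b.src ∉ Λ`, `b.tgt ∈ Λ`); as
elements of `st(Λ)` they are the reversed bonds `−b = ⟨b.tgt, b.src⟩`: `b₋ = b.tgt`, `b₊ = b.src`, `A_{−b} = −A_b` (I p. 604).
[cite: Balaban1982Higgs2, (2.29) p.563] -/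
def stBwd (Ω Λ : Finset (HiggsLattice.Site P k)) : Finset (HiggsLattice.PBond P k) :=
  Finset.univ.filter fun b => b.src ∈ Ω ∧ b.tgt ∈ Ω ∧ b.tgt ∈ Λ ∧ b.src ∉ Λ

/-- Membership in `stFwd`. [cite: Balaban1982Higgs2, (2.29) p.563] -/
theorem mem_stFwd (Ω Λ : Finset (HiggsLattice.Site P k)) (b : HiggsLattice.PBond P k) :
    b ∈ stFwd Ω Λ ↔ b.src ∈ Ω ∧ b.tgt ∈ Ω ∧ b.src ∈ Λ ∧ b.tgt ∉ Λ := by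
  simp [stFwd]

/-- Membership in `stBwd`. [cite: Balaban1982Higgs2, (2.29) p.563] -/
theorem mem_stBwd (Ω Λ : Finset (HiggsLattice.Site P k)) (b : HiggsLattice.PBond P k) :
    b ∈ stBwd Ω Λ ↔ b.src ∈ Ω ∧ b.tgt ∈ Ω ∧ b.tgt ∈ Λ ∧ b.src ∉ Λ := by
  simp [stBwd]

/-- **`∂Λ₅ = {x ∈ Λ₅ᶜ : x = b₊ for some b ∈ st(Λ₅)}`** p. 563: the exterior endpoints of the boundary bonds.
[cite: Balaban1982Higgs2, (2.30) p.563] -/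
def bdrySites (Ω Λ : Finset (HiggsLattice.Site P k)) : Finset (HiggsLattice.Site P k) :=
  (stFwd Ω Λ).image HiggsLattice.PBond.tgt ∪ (stBwd Ω Λ).image HiggsLattice.PBond.src

/-- `b₊ ∈ ∂Λ` for `b` in the forward part of `st(Λ)`. [cite: Balaban1982Higgs2, (2.30) p.563] -/
theorem tgt_mem_bdrySites {Ω Λ : Finset (HiggsLattice.Site P k)} {b : HiggsLattice.PBond P k} (hb : b ∈ stFwd Ω Λ) :
    b.tgt ∈ bdrySites Ω Λ :=
  Finset.mem_union_left _ (Finset.mem_image_of_mem _ hb)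

/-- `b₊ ∈ ∂Λ` for `b` in the backward part of `st(Λ)` (`b₊ = b.src`). [cite: Balaban1982Higgs2, (2.30) p.563] -/
theorem src_mem_bdrySites {Ω Λ : Finset (HiggsLattice.Site P k)} {b : HiggsLattice.PBond P k} (hb : b ∈ stBwd Ω Λ) :
    b.src ∈ bdrySites Ω Λ :=
  Finset.mem_union_right _ (Finset.mem_image_of_mem _ hb)

/-- `∂Λ ⊂ Λᶜ`. [cite: Balaban1982Higgs2, (2.30) p.563] -/
theorem not_mem_of_mem_bdrySites {Ω Λ : Finset (HiggsLattice.Site P k)} {x : HiggsLattice.Site P k}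
    (hx : x ∈ bdrySites Ω Λ) : x ∉ Λ := by
  unfold bdrySites at hx
  rcases Finset.mem_union.mp hx with h | h
  · obtain ⟨b, hb, rfl⟩ := Finset.mem_image.mp h
    exact ((mem_stFwd Ω Λ b).mp hb).2.2.2
  · obtain ⟨b, hb, rfl⟩ := Finset.mem_image.mp h
    exact ((mem_stBwd Ω Λ b).mp hb).2.2.2

/-! ### The unweighted kernel of an operator on fields (I (2.24)): `(Gψ)(x) = Σ_{x′} G(x, x′)ψ(x′)` -/

/-- The kernel acts on a point mass: `G(x, x′)v = (G(δ_{x′}v))(x)` (definitional). [cite: Balaban1982Higgs1, (2.24) p.610] -/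
theorem kernel_apply_single (G : Module.End ℝ (ScalarField P k N)) (x x' : HiggsLattice.Site P k) (v : E N) :
    kernel G x x' v = G (Pi.single x' v) x := rfl

/-- **Kernel expansion**: `(Gψ)(x) = Σ_{x′ ∈ T^{(k)}} G(x, x′)ψ(x′)` for every linear operator on the fields (the unweighted
coordinate kernel; the (1.5)-kernel is `(L^kε)^{−d}` times it). [cite: Balaban1982Higgs1, (2.24) p.610] -/
theorem apply_eq_sum_kernel (G : Module.End ℝ (ScalarField P k N)) (ψ : ScalarField P k N) (x : HiggsLattice.Site P k) :
    G ψ x = ∑ x' : HiggsLattice.Site P k, kernel G x x' (ψ x') := by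
  conv_lhs => rw [← Finset.univ_sum_single ψ]
  rw [map_sum, Finset.sum_apply]
  rfl

/-- A sum over the positively oriented bonds is a sum over sites and directions (`HiggsCovariancePos.sum_site_dir`,
re-oriented). [cite: Balaban1982Higgs1, (1.4) p.604] -/
theorem sum_pbond {M : Type*} [AddCommMonoid M] (G : HiggsLattice.PBond P k → M) :
    ∑ b : HiggsLattice.PBond P k, G b = ∑ x : HiggsLattice.Site P k, ∑ μ : Fin P.d, G ⟨x, μ⟩ := by
  rw [sum_site_dir (fun x μ => G ⟨x, μ⟩)]

variable (C : ChargeData N) (Ω : Finset (HiggsLattice.Site P 0)) (A : HiggsLattice.VecField P 0)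

/-- **The `Λᶜ → Λ` coupling of the first-step form through the boundary bonds**, pointwise:
`bdryField φ (x) = Σ_μ [⟨x,x+εe_μ⟩ ∈ stFwd]·U(A_{⟨x,x+εe_μ⟩})φ(x+εe_μ) + Σ_μ [⟨x−εe_μ,x⟩ ∈ stBwd]·U(−A_{⟨x−εe_μ,x⟩})φ(x−εe_μ)`.
[cite: Balaban1982Higgs2, (2.30) p.563] -/
noncomputable def bdryField (Λ : Finset (HiggsLattice.Site P 0)) (φ : ScalarField P 0 N) : ScalarField P 0 N := fun x =>
  ∑ μ : Fin P.d,
    ((if x ∈ Ω ∧ x.shift μ ∈ Ω ∧ x ∈ Λ ∧ x.shift μ ∉ Λ then C.U (P.mesh 0) (A ⟨x, μ⟩) (φ (x.shift μ)) else 0)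
      + (if x.unshift μ ∈ Ω ∧ x ∈ Ω ∧ x ∈ Λ ∧ x.unshift μ ∉ Λ
          then C.U (P.mesh 0) (-(A ⟨x.unshift μ, μ⟩)) (φ (x.unshift μ)) else 0))

/-- **`bdryField` as a sum over `st(Λ)` of point masses at `b₋`**:
`bdryField φ = Σ_{b∈stFwd} δ_{b.src}·U(A_b)φ(b.tgt) + Σ_{b∈stBwd} δ_{b.tgt}·U(−A_b)φ(b.src)`. [cite: Balaban1982Higgs2, (2.30) p.563] -/
theorem bdryField_eq_sum_single (Λ : Finset (HiggsLattice.Site P 0)) (φ : ScalarField P 0 N) :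
    bdryField C Ω A Λ φ
      = ∑ b ∈ stFwd Ω Λ, Pi.single b.src (C.U (P.mesh 0) (A b) (φ b.tgt))
        + ∑ b ∈ stBwd Ω Λ, Pi.single b.tgt (C.U (P.mesh 0) (-(A b)) (φ b.src)) := by
  funext x
  rw [Pi.add_apply, Finset.sum_apply, Finset.sum_apply, bdryField, Finset.sum_add_distrib]
  congr 1
  · -- forward bonds `b = ⟨x', μ⟩`: only `x' = x` contributes at the site `x`
    rw [stFwd, Finset.sum_filter, sum_pbond, Finset.sum_comm]
    refine Finset.sum_congr rfl fun μ _ => ?_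
    rw [Finset.sum_eq_single_of_mem x (Finset.mem_univ x) (fun x' _ hne => ?_)]
    · show _ = (if x ∈ Ω ∧ x.shift μ ∈ Ω ∧ x ∈ Λ ∧ x.shift μ ∉ Λ
          then (Pi.single x (C.U (P.mesh 0) (A ⟨x, μ⟩) (φ (x.shift μ))) : ScalarField P 0 N) x else 0)
      by_cases hc : x ∈ Ω ∧ x.shift μ ∈ Ω ∧ x ∈ Λ ∧ x.shift μ ∉ Λ
      · rw [if_pos hc, if_pos hc, Pi.single_eq_same]
      · rw [if_neg hc, if_neg hc]
    · split_ifs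
      · exact Pi.single_eq_of_ne hne.symm _
      · rfl
  · -- backward bonds `b = ⟨x', μ⟩` with `b.tgt = x`: only `x' = x − εe_μ` contributes
    rw [stBwd, Finset.sum_filter, sum_pbond, Finset.sum_comm]
    refine Finset.sum_congr rfl fun μ _ => ?_
    rw [Finset.sum_eq_single_of_mem (x.unshift μ) (Finset.mem_univ _) (fun x' _ hne => ?_)]
    · show _ = (if x.unshift μ ∈ Ω ∧ (x.unshift μ).shift μ ∈ Ω ∧ (x.unshift μ).shift μ ∈ Λ ∧ x.unshift μ ∉ Λ
          then (Pi.single ((x.unshift μ).shift μ)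
              (C.U (P.mesh 0) (-(A ⟨x.unshift μ, μ⟩)) (φ (x.unshift μ))) : ScalarField P 0 N) x else 0)
      rw [shift_unshift]
      by_cases hc : x.unshift μ ∈ Ω ∧ x ∈ Ω ∧ x ∈ Λ ∧ x.unshift μ ∉ Λ
      · rw [if_pos hc, if_pos hc, Pi.single_eq_same]
      · rw [if_neg hc, if_neg hc]
    · have hne' : x ≠ x'.shift μ := fun h => hne (by rw [h, unshift_shift])
      split_ifs
      · exact Pi.single_eq_of_ne hne' _
      · rfl

variable (msq a : ℝ)

/-- **`P(A) = Q^*(A)Q(A)` does not couple a union of blocks to its complement**: for `Λ = B(Λ′)` and `x ∈ Λ`,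
`(P(A)·Λᶜφ)(x) = 0` (the block `B(x₁)` of `x` lies in `Λ`, where `Λᶜφ = 0`). [cite: Balaban1982Higgs1, (2.7) p.608] -/
theorem blockProjA_cutTo_compl_apply (Λ' : Finset (HiggsLattice.Site P 1)) (φ : ScalarField P 0 N)
    {x : HiggsLattice.Site P 0} (hx : x ∈ HiggsLattice.blockSet Λ') :
    blockProjA C A 0 (cutTo (HiggsLattice.blockSet Λ')ᶜ φ) x = 0 := by
  rw [blockProjA, LinearMap.comp_apply, avgQAdjLin_apply]
  have h0 : avgQLin C A 0 (cutTo (HiggsLattice.blockSet Λ')ᶜ φ) (HiggsLattice.blockOf x) = 0 := by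
    refine avgQLin_apply_eq_zero C A 0 fun x'' hx'' => ?_
    have hb : HiggsLattice.blockOf x'' = HiggsLattice.blockOf x := by simpa [HiggsLattice.block] using hx''
    have hmem : x'' ∈ HiggsLattice.blockSet Λ' := by
      rw [HiggsLattice.mem_blockSet, hb]; exact (HiggsLattice.mem_blockSet Λ' x).mp hx
    exact cutTo_of_not_mem _ φ (fun h => (Finset.mem_compl.mp h) hmem)
  rw [h0, map_zero]

/-- One forward Neumann term of `−Δ^{ε,N}_{A,Ω}` on `Λᶜφ` at `x ∈ Λ`: `−[⟨x,x+εe_μ⟩ ∈ stFwd]·U(A_{⟨x,x+εe_μ⟩})φ(x+εe_μ)`.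
[cite: Balaban1982Higgs1, (2.17) p.610] -/
theorem fwdTerm_cutTo_compl (Λ : Finset (HiggsLattice.Site P 0)) (φ : ScalarField P 0 N) {x : HiggsLattice.Site P 0}
    (hx : x ∈ Λ) (μ : Fin P.d) :
    fwdTerm C Ω A x μ (cutTo Λᶜ φ)
      = -(if x ∈ Ω ∧ x.shift μ ∈ Ω ∧ x ∈ Λ ∧ x.shift μ ∉ Λ then C.U (P.mesh 0) (A ⟨x, μ⟩) (φ (x.shift μ)) else 0) := by
  rw [fwdTerm_apply, cutTo_of_not_mem Λᶜ φ (fun h => (Finset.mem_compl.mp h) hx)]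
  by_cases h1 : x ∈ Ω ∧ x.shift μ ∈ Ω
  · by_cases h2 : x.shift μ ∈ Λ
    · rw [cutTo_of_not_mem Λᶜ φ (fun h => (Finset.mem_compl.mp h) h2)]
      simp [h1, h2]
    · rw [cutTo_of_mem Λᶜ φ (Finset.mem_compl.mpr h2)]
      simp [h1, h2, hx]
  · have h1' : ¬ (x ∈ Ω ∧ x.shift μ ∈ Ω ∧ x ∈ Λ ∧ x.shift μ ∉ Λ) := fun h => h1 ⟨h.1, h.2.1⟩
    rw [if_neg h1, if_neg h1', neg_zero]

/-- One backward Neumann term of `−Δ^{ε,N}_{A,Ω}` on `Λᶜφ` at `x ∈ Λ`: `−[⟨x−εe_μ,x⟩ ∈ stBwd]·U(−A_{⟨x−εe_μ,x⟩})φ(x−εe_μ)`.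
[cite: Balaban1982Higgs1, (2.17) p.610] -/
theorem bwdTerm_cutTo_compl (Λ : Finset (HiggsLattice.Site P 0)) (φ : ScalarField P 0 N) {x : HiggsLattice.Site P 0}
    (hx : x ∈ Λ) (μ : Fin P.d) :
    bwdTerm C Ω A x μ (cutTo Λᶜ φ)
      = -(if x.unshift μ ∈ Ω ∧ x ∈ Ω ∧ x ∈ Λ ∧ x.unshift μ ∉ Λ
          then C.U (P.mesh 0) (-(A ⟨x.unshift μ, μ⟩)) (φ (x.unshift μ)) else 0) := by
  rw [bwdTerm_apply, cutTo_of_not_mem Λᶜ φ (fun h => (Finset.mem_compl.mp h) hx)]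
  by_cases h1 : x ∈ Ω ∧ x.unshift μ ∈ Ω
  · by_cases h2 : x.unshift μ ∈ Λ
    · rw [cutTo_of_not_mem Λᶜ φ (fun h => (Finset.mem_compl.mp h) h2)]
      simp [h1, h2]
    · rw [cutTo_of_mem Λᶜ φ (Finset.mem_compl.mpr h2)]
      simp [h1, h2, hx]
  · have h1' : ¬ (x.unshift μ ∈ Ω ∧ x ∈ Ω ∧ x ∈ Λ ∧ x.unshift μ ∉ Λ) := fun h => h1 ⟨h.2.1, h.1⟩
    rw [if_neg h1, if_neg h1', neg_zero]

/-- **The boundary-coupling identity** (the hypothesis `hst` of p15's `display229`/`display230`, as a THEOREM for the concrete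
first-step form): for `Λ = B(Λ′)` a union of blocks,
`Λ·(a(Lε)^{−2}P(A) + (−Δ^{ε,N}_{A,Ω} + m²))·Λᶜφ = −ε⁻²·bdryField φ` — the main quadratic form couples `Λ` to `Λᶜ` ONLY through
the nearest-neighbour bonds `st(Λ)` inside `Ω`, with the couplings `−ε⁻²U(A_b)`. [cite: Balaban1982Higgs2, (2.30) p.563] -/
theorem cutTo_precOpA_cutTo_compl (Λ' : Finset (HiggsLattice.Site P 1)) (φ : ScalarField P 0 N) :
    cutTo (HiggsLattice.blockSet Λ') (precOpA C Ω A msq a 0 (cutTo (HiggsLattice.blockSet Λ')ᶜ φ))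
      = -(((P.mesh 0)⁻¹ ^ 2) • bdryField C Ω A (HiggsLattice.blockSet Λ') φ) := by
  funext x
  by_cases hx : x ∈ HiggsLattice.blockSet Λ'
  · rw [cutTo_of_mem _ _ hx, precOpA, LinearMap.add_apply, LinearMap.smul_apply, Pi.add_apply, Pi.smul_apply,
      blockProjA_cutTo_compl_apply C A Λ' φ hx, smul_zero, zero_add, deltaKA_zero, delta0, LinearMap.add_apply,
      Pi.add_apply, LinearMap.smul_apply, LinearMap.id_apply, Pi.smul_apply,
      cutTo_of_not_mem _ φ (fun h => (Finset.mem_compl.mp h) hx), smul_zero, add_zero]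
    have hL : covLaplacianN C Ω A (cutTo (HiggsLattice.blockSet Λ')ᶜ φ) x
        = ((P.mesh 0)⁻¹ ^ 2) • ∑ μ : Fin P.d,
            (fwdTerm C Ω A x μ (cutTo (HiggsLattice.blockSet Λ')ᶜ φ) + bwdTerm C Ω A x μ (cutTo (HiggsLattice.blockSet Λ')ᶜ φ)) := by
      simp only [covLaplacianN, LinearMap.pi_apply, LinearMap.smul_apply, LinearMap.coe_sum, Finset.sum_apply,
        LinearMap.add_apply]
    rw [hL, Pi.neg_apply, Pi.smul_apply, ← smul_neg]
    congr 1
    rw [bdryField, ← Finset.sum_neg_distrib]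
    refine Finset.sum_congr rfl fun μ _ => ?_
    rw [fwdTerm_cutTo_compl C Ω A _ φ hx μ, bwdTerm_cutTo_compl C Ω A _ φ hx μ, neg_add]
  · rw [cutTo_of_not_mem _ _ hx, Pi.neg_apply, Pi.smul_apply]
    have h0 : bdryField C Ω A (HiggsLattice.blockSet Λ') φ x = 0 := by
      rw [bdryField]
      refine Finset.sum_eq_zero fun μ _ => ?_
      rw [if_neg (fun h => hx h.2.2.1), if_neg (fun h => hx h.2.2.1), add_zero]
    rw [h0, smul_zero, neg_zero]

end Boundary

/-! ## §3 (2.30) and (2.29) on the concrete carrier -/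

section Display

variable (C : ChargeData N) (Ω : Finset (HiggsLattice.Site P 0)) (A : HiggsLattice.VecField P 0) (msq a : ℝ)

/-- **(2.30) p. 563 PROVED on the concrete carrier**: for `Λ = B(Λ′)` a union of blocks of `T_ε` and EVERY `C, Ω, A, m², a,
φ′, x`, the shift of (2.28) for the scalar field is the boundary sum
`(−C^{(0)}_Λ(Ω,A)·Λ·(a(Lε)^{−2}P(A) + Δ^{(0)}(Ω,A))·Λᶜφ′)(x) = ε⁻²·[Σ_{b∈stFwd} C^{(0)}_Λ(A; x, b.src)·U(A_b)φ′(b.tgt)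
 + Σ_{b∈stBwd} C^{(0)}_Λ(A; x, b.tgt)·U(−A_b)φ′(b.src)]` = *"Σ_{b∈st(Λ₅)} C^{(0)}_{Λ₅}(B^{(1)}; x, b₋)U(B_b^{(1)})φ′(b₊)"* with
`st(Λ₅) = stFwd ⊔ (−stBwd)`, `C^{(0)}_Λ(x, x′)` the unweighted kernel; for `x ∉ Λ` both sides vanish. [cite: Balaban1982Higgs2, (2.30) p.563] -/
theorem condShiftField_zero_apply (Λ' : Finset (HiggsLattice.Site P 1)) (φ : ScalarField P 0 N) (x : HiggsLattice.Site P 0) :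
    condShiftField C Ω A msq a 0 (HiggsLattice.blockSet Λ') φ x
      = ((P.mesh 0)⁻¹ ^ 2) •
        (∑ b ∈ stFwd Ω (HiggsLattice.blockSet Λ'),
            kernel (condCov232 C Ω A msq a 0 (HiggsLattice.blockSet Λ')) x b.src (C.U (P.mesh 0) (A b) (φ b.tgt))
          + ∑ b ∈ stBwd Ω (HiggsLattice.blockSet Λ'),
            kernel (condCov232 C Ω A msq a 0 (HiggsLattice.blockSet Λ')) x b.tgt (C.U (P.mesh 0) (-(A b)) (φ b.src))) := by
  rw [condShiftField_eq, cutTo_precOpA_cutTo_compl, map_neg, neg_neg, map_smul, Pi.smul_apply,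
    bdryField_eq_sum_single, map_add, map_sum, map_sum, Pi.add_apply, Finset.sum_apply, Finset.sum_apply]
  rfl

/-- **(2.30) in the printed shape**: for `x ∈ Λ = B(Λ′)`, *"(φ′ − A_Λ⁻¹Aφ↾_{Λᶜ})(x) = φ′(x) + Σ_{b∈st(Λ₅)} C^{(0)}_{Λ₅}(B^{(1)};
x, b₋)U(B_b^{(1)})φ′(b₊), x ∈ Λ₅"* — `φ′` the integration variable of `dμ_{C^{(0)}_{Λ₅}}` (a configuration on `Λ`), `φ` the
conditioned exterior configuration. [cite: Balaban1982Higgs2, (2.30) p.563] -/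
theorem display230_concrete (Λ' : Finset (HiggsLattice.Site P 1)) (φ' φ : ScalarField P 0 N) {x : HiggsLattice.Site P 0}
    (hx : x ∈ HiggsLattice.blockSet Λ') :
    (cutTo (HiggsLattice.blockSet Λ') φ' + condShiftField C Ω A msq a 0 (HiggsLattice.blockSet Λ') φ) x
      = φ' x + ((P.mesh 0)⁻¹ ^ 2) •
        (∑ b ∈ stFwd Ω (HiggsLattice.blockSet Λ'),
            kernel (condCov232 C Ω A msq a 0 (HiggsLattice.blockSet Λ')) x b.src (C.U (P.mesh 0) (A b) (φ b.tgt))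
          + ∑ b ∈ stBwd Ω (HiggsLattice.blockSet Λ'),
            kernel (condCov232 C Ω A msq a 0 (HiggsLattice.blockSet Λ')) x b.tgt (C.U (P.mesh 0) (-(A b)) (φ b.src))) := by
  rw [Pi.add_apply, cutTo_of_mem _ _ hx, condShiftField_zero_apply]

/-- **(2.29) p. 563 PROVED on the concrete carrier** — the VECTOR-field shift: at external field `0` the transports are
`U(0) = 1` and the scalar letters at `N = d`, trivial coupling are the vector species of the model (I p. 608 *"N = d and
an external vector field A = 0"*; typer `HiggsFluctMeasure`/`B1Eq230FluctCov.precOpA_zero_field`), so for `Λ = B(Λ′)`: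
`(−C^{(0)}_Λ·Λ·(a(Lε)^{−2}P + Δ^{(0)}(Ω))·ΛᶜA′)(x) = ε⁻²·[Σ_{b∈stFwd} C^{(0)}_Λ(x, b.src)A′(b.tgt) + Σ_{b∈stBwd} C^{(0)}_Λ(x, b.tgt)A′(b.src)]`
= *"Σ_{b∈st(Λ₅)} C^{(0)}_{Λ₅}(x, b₋)A′(b₊)"* (the print takes `Ω = T₁`, no Neumann conditions for the vector field; any `Ω`
here). [cite: Balaban1982Higgs2, (2.29) p.563] -/
theorem condShiftField_zero_field_apply (Λ' : Finset (HiggsLattice.Site P 1)) (B : ScalarField P 0 N)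
    (x : HiggsLattice.Site P 0) :
    condShiftField C Ω (0 : HiggsLattice.VecField P 0) msq a 0 (HiggsLattice.blockSet Λ') B x
      = ((P.mesh 0)⁻¹ ^ 2) •
        (∑ b ∈ stFwd Ω (HiggsLattice.blockSet Λ'),
            kernel (condCov232 C Ω (0 : HiggsLattice.VecField P 0) msq a 0 (HiggsLattice.blockSet Λ')) x b.src (B b.tgt)
          + ∑ b ∈ stBwd Ω (HiggsLattice.blockSet Λ'),
            kernel (condCov232 C Ω (0 : HiggsLattice.VecField P 0) msq a 0 (HiggsLattice.blockSet Λ')) x b.tgt (B b.src)) := by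
  rw [condShiftField_zero_apply]
  simp only [Pi.zero_apply, neg_zero, ChargeData.U_zero, one_apply_eq_self]

/-- **p. 563: the second term of (2.29)/(2.30) depends on `φ′` only through `φ′↾_{∂Λ₅}`**,
`∂Λ₅ = {x ∈ Λ₅ᶜ : x = b₊ for some b ∈ st(Λ₅)}` (`bdrySites`): two exterior configurations agreeing on `∂Λ` have the same shift.
[cite: Balaban1982Higgs2, (2.30) p.563] -/
theorem condShiftField_eq_of_eqOn_bdrySites (Λ' : Finset (HiggsLattice.Site P 1)) {φ₁ φ₂ : ScalarField P 0 N}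
    (h : ∀ y ∈ bdrySites Ω (HiggsLattice.blockSet Λ'), φ₁ y = φ₂ y) :
    condShiftField C Ω A msq a 0 (HiggsLattice.blockSet Λ') φ₁ = condShiftField C Ω A msq a 0 (HiggsLattice.blockSet Λ') φ₂ := by
  funext x
  rw [condShiftField_zero_apply, condShiftField_zero_apply]
  congr 2
  · exact Finset.sum_congr rfl fun b hb => by rw [h b.tgt (tgt_mem_bdrySites hb)]
  · exact Finset.sum_congr rfl fun b hb => by rw [h b.src (src_mem_bdrySites hb)]

end Display

/-! ## §4 (v1.1) p. 563: «the second terms in (2.29), (2.30) can be estimated by O(1)p(ε)» — the mechanism -/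

section Estimate

variable {k : ℕ}

/-- Each site is the initial point of exactly `d` positively oriented bonds: `Σ_b g(b₋) = d·Σ_x g(x)`.
[cite: Balaban1982Higgs1, (1.4) p.604] -/
theorem sum_pbond_src (g : HiggsLattice.Site P k → ℝ) :
    ∑ b : HiggsLattice.PBond P k, g b.src = (P.d : ℝ) * ∑ x : HiggsLattice.Site P k, g x := by
  rw [sum_pbond (fun b => g b.src), Finset.mul_sum]
  refine Finset.sum_congr rfl fun x _ => ?_
  simp only [Finset.sum_const, Finset.card_univ, Fintype.card_fin, nsmul_eq_mul]

/-- Each site is the final point of exactly `d` positively oriented bonds: `Σ_b g(b₊) = d·Σ_x g(x)` (translation by `εe_μ`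
is a bijection of the torus). [cite: Balaban1982Higgs1, (1.4) p.604] -/
theorem sum_pbond_tgt (g : HiggsLattice.Site P k → ℝ) :
    ∑ b : HiggsLattice.PBond P k, g b.tgt = (P.d : ℝ) * ∑ x : HiggsLattice.Site P k, g x := by
  rw [sum_pbond (fun b => g b.tgt), Finset.sum_comm]
  have h : ∀ μ : Fin P.d, ∑ x : HiggsLattice.Site P k, g ((⟨x, μ⟩ : HiggsLattice.PBond P k).tgt)
      = ∑ x : HiggsLattice.Site P k, g x := fun μ => (shiftEquiv P k μ).sum_comp g
  simp only [h, Finset.sum_const, Finset.card_univ, Fintype.card_fin, nsmul_eq_mul]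

variable (C : ChargeData N) (Ω : Finset (HiggsLattice.Site P 0)) (A : HiggsLattice.VecField P 0) (msq a : ℝ)

/-- **p. 563, verbatim: *"Because the fields A′, φ′ are small on ∂Λ₅ = {x ∈ Λ₅ᶜ : x = b₊ for some b ∈ st(Λ₅)}, the second terms
in (2.29), (2.30) can be estimated by O(1)p(ε)"* — the mechanism, PROVED on the concrete carrier**: if the (unweighted) kernel
of `C^{(0)}_Λ(Ω,A)` is dominated in operator norm, `‖C^{(0)}_Λ(x,x′)v‖ ≤ c(x,x′)‖v‖` with `c ≥ 0` (the shape of (2.34):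
`c(x,x′) = c₀e^{−δ₀|x−x′|}`), and `‖φ′(y)‖ ≤ p` for `y ∈ ∂Λ` (`Λ = B(Λ′)`), then for every `x`
`‖(second term of (2.30))(x)‖ ≤ ε⁻²·(2d·Σ_{x′}c(x,x′))·p` — by `|U(A_b)v| = |v|` (p. 605) and the bond counts
`sum_pbond_src`/`sum_pbond_tgt`.  The ε-uniform size of `2d·Σ_{x′}c(x,x′)` (the print's `O(1)`) is (2.34)'s content and is
not asserted here. [cite: Balaban1982Higgs2, (2.30) p.563] -/
theorem norm_condShiftField_zero_le (Λ' : Finset (HiggsLattice.Site P 1)) {φ : ScalarField P 0 N}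
    {c : HiggsLattice.Site P 0 → HiggsLattice.Site P 0 → ℝ} {p : ℝ}
    (hK : ∀ (x x' : HiggsLattice.Site P 0) (v : E N),
      ‖kernel (condCov232 C Ω A msq a 0 (HiggsLattice.blockSet Λ')) x x' v‖ ≤ c x x' * ‖v‖)
    (hc : ∀ x x', 0 ≤ c x x') (hp : 0 ≤ p)
    (hφ : ∀ y ∈ bdrySites Ω (HiggsLattice.blockSet Λ'), ‖φ y‖ ≤ p) (x : HiggsLattice.Site P 0) :
    ‖condShiftField C Ω A msq a 0 (HiggsLattice.blockSet Λ') φ x‖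
      ≤ (P.mesh 0)⁻¹ ^ 2 * (2 * (P.d : ℝ) * ∑ x' : HiggsLattice.Site P 0, c x x') * p := by
  rw [condShiftField_zero_apply, norm_smul, Real.norm_of_nonneg (pow_nonneg (inv_nonneg.mpr (P.mesh_pos 0).le) 2)]
  have hU : ∀ (s : ℝ) (v : E N), ‖C.U (P.mesh 0) s v‖ = ‖v‖ := fun s v =>
    ContinuousLinearMap.norm_map_of_mem_unitary (C.U_mem_unitary (P.mesh 0) s) v
  have hF : ‖∑ b ∈ stFwd Ω (HiggsLattice.blockSet Λ'),
        kernel (condCov232 C Ω A msq a 0 (HiggsLattice.blockSet Λ')) x b.src (C.U (P.mesh 0) (A b) (φ b.tgt))‖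
      ≤ ((P.d : ℝ) * ∑ x' : HiggsLattice.Site P 0, c x x') * p := by
    calc ‖∑ b ∈ stFwd Ω (HiggsLattice.blockSet Λ'),
            kernel (condCov232 C Ω A msq a 0 (HiggsLattice.blockSet Λ')) x b.src (C.U (P.mesh 0) (A b) (φ b.tgt))‖
        ≤ ∑ b ∈ stFwd Ω (HiggsLattice.blockSet Λ'),
            ‖kernel (condCov232 C Ω A msq a 0 (HiggsLattice.blockSet Λ')) x b.src (C.U (P.mesh 0) (A b) (φ b.tgt))‖ :=
          norm_sum_le _ _
      _ ≤ ∑ b ∈ stFwd Ω (HiggsLattice.blockSet Λ'), c x b.src * p := by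
          refine Finset.sum_le_sum fun b hb => (hK x b.src _).trans ?_
          rw [hU]
          exact mul_le_mul_of_nonneg_left (hφ b.tgt (tgt_mem_bdrySites hb)) (hc x b.src)
      _ ≤ ∑ b : HiggsLattice.PBond P 0, c x b.src * p :=
          Finset.sum_le_univ_sum_of_nonneg fun b => mul_nonneg (hc x b.src) hp
      _ = ((P.d : ℝ) * ∑ x' : HiggsLattice.Site P 0, c x x') * p := by
          rw [← Finset.sum_mul, sum_pbond_src]
  have hB : ‖∑ b ∈ stBwd Ω (HiggsLattice.blockSet Λ'),
        kernel (condCov232 C Ω A msq a 0 (HiggsLattice.blockSet Λ')) x b.tgt (C.U (P.mesh 0) (-(A b)) (φ b.src))‖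
      ≤ ((P.d : ℝ) * ∑ x' : HiggsLattice.Site P 0, c x x') * p := by
    calc ‖∑ b ∈ stBwd Ω (HiggsLattice.blockSet Λ'),
            kernel (condCov232 C Ω A msq a 0 (HiggsLattice.blockSet Λ')) x b.tgt (C.U (P.mesh 0) (-(A b)) (φ b.src))‖
        ≤ ∑ b ∈ stBwd Ω (HiggsLattice.blockSet Λ'),
            ‖kernel (condCov232 C Ω A msq a 0 (HiggsLattice.blockSet Λ')) x b.tgt (C.U (P.mesh 0) (-(A b)) (φ b.src))‖ :=
          norm_sum_le _ _
      _ ≤ ∑ b ∈ stBwd Ω (HiggsLattice.blockSet Λ'), c x b.tgt * p := by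
          refine Finset.sum_le_sum fun b hb => (hK x b.tgt _).trans ?_
          rw [hU]
          exact mul_le_mul_of_nonneg_left (hφ b.src (src_mem_bdrySites hb)) (hc x b.tgt)
      _ ≤ ∑ b : HiggsLattice.PBond P 0, c x b.tgt * p :=
          Finset.sum_le_univ_sum_of_nonneg fun b => mul_nonneg (hc x b.tgt) hp
      _ = ((P.d : ℝ) * ∑ x' : HiggsLattice.Site P 0, c x x') * p := by
          rw [← Finset.sum_mul, sum_pbond_tgt]
  calc (P.mesh 0)⁻¹ ^ 2 * ‖∑ b ∈ stFwd Ω (HiggsLattice.blockSet Λ'),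
            kernel (condCov232 C Ω A msq a 0 (HiggsLattice.blockSet Λ')) x b.src (C.U (P.mesh 0) (A b) (φ b.tgt))
          + ∑ b ∈ stBwd Ω (HiggsLattice.blockSet Λ'),
            kernel (condCov232 C Ω A msq a 0 (HiggsLattice.blockSet Λ')) x b.tgt (C.U (P.mesh 0) (-(A b)) (φ b.src))‖
      ≤ (P.mesh 0)⁻¹ ^ 2 * ((((P.d : ℝ) * ∑ x' : HiggsLattice.Site P 0, c x x') * p)
          + (((P.d : ℝ) * ∑ x' : HiggsLattice.Site P 0, c x x') * p)) := by
        refine mul_le_mul_of_nonneg_left ((norm_add_le _ _).trans (add_le_add hF hB)) ?_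
        exact pow_nonneg (inv_nonneg.mpr (P.mesh_pos 0).le) 2
    _ = (P.mesh 0)⁻¹ ^ 2 * (2 * (P.d : ℝ) * ∑ x' : HiggsLattice.Site P 0, c x x') * p := by ring

end Estimate

end Literature.MathematicalPhysics.QuantumFieldTheory.Balaban1983to89.B2Eq230CondShift
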